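import Summits.QuantumFields.YangMills.Theorems.BalabanUVNodesK0V23Stub1Closer
import Literature.MathematicalPhysics.QuantumFieldTheory.Balaban1983to89.B8Prop6PrintedZdCubPGamma
import Summits.QuantumFields.YangMills.Theses.BalabanUVNodes
import Summits.QuantumFields.YangMills.Theorems.BalabanUVNodesK0AllTorusOfStepTokensGuardedZBLamPrintAx
import Summits.QuantumFields.YangMills.Theorems.BalabanUVNodesK0V23Stub3ComparabilitySuppliersAx
import Summits.QuantumFields.YangMills.Theorems.BalabanUVNodesK0V23Stub3SocketsAx

/-!
# K0ᴬ (stmt-QuantumFields-27238 `Record13SepCoPHInhabitedAx`) — `…K0V23Stub3DoorSuppliers` RE-CENTRED (OP 5a ∕ H3.3, the Ax EDITION): the three K0 DOORS of record on the RADIUS axis,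
# (α_small) `K0BoxSmallRadiiAx` ⟸ (α_cof) `K0BoxCofinalRadiiAx` ⟸ (κ_cof) `K0CompCofinalRadiiAx`, at the re-centred β `betaOfRecord₁₃Ax ∘ theta13OfThm1CCMWZBAx`, each closing K0ᴬ
# `Record13SepCoPHInhabitedAx` BY NAME (director-ym №398 (A)∕(B) doors list, re-issued for the re-centred crux)

Cell `pub-ymgap` (YM-PLAN Track A, D-0062), width seat `pub-ymgap-dag-n07-w3` (g22; dag-lead g40 HANDS-3 H3.3 «Summits side, piecewise after H3.1 lands: the Ax∕χ editions … new basenames,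
`--supports stmt-QuantumFields-27238 --as helper`»).  COUNT-NEUTRAL; theorems + the three door `def … : Prop` texts re-centred (`--kind definition`, review lane) — 0 `sorry` ∕ `instance` ∕ `notation`; NEW additive leaf — ym-nodeO-def-1 g32's `…K0V23Stub3DoorSuppliers` (229 l., key 20541 = K0⁷, banked as an
aside by director-ym №467 (D)) stays landed and true on its own text; nothing in the tree is edited.

WHAT THIS FILE IS.  The σ-IMAGE of `…K0V23Stub3DoorSuppliers` under director-ym №467 (D)'s re-centring of K0 (K0⁷ `Record13SepCoPHInhabited` ↦ K0ᴬ `Record13SepCoPHInhabitedAx`, stmt-QuantumFields-27238):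
σ = { `theta13OfThm1CCMWZB ↦ theta13OfThm1CCMWZBAx` (def-Y (c) `Node00/Record13NumericsOfThm1CCMWZBChi`, SAME ARITY; letters `X_theta13OfThm1CCMWZBAx` of (c) ∕ (d) `Record13LettersOfThm1CCMWZBChi`),
`betaOfRecord₁₃ ↦ betaOfRecord₁₃Ax`, `gOfRecord₁₃ ↦ gOfRecord₁₃Ax` ([Ax-3a∕b]), `Provisos₁₃SepCoPH ∕ SlotsNondegenerate₁₃ ↦ …Ax`, `UbgOfRecord₁₃CoP θ ↦ UbgOfRecord₁₃CoPChi θ (chiβOfRecord₁₃Ax θ)`,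
`PartCompat₁₃ θ ↦ PartCompat₁₃Chi θ (chiβOfRecord₁₃Ax θ)`, texts `K0V23Defs.AbsBetaBox…GZB{,Eps0}At ↦ K0V23DefsAx.…AxAt` (p803783; stub 1ᴮ `Prop8StepCoPGridGBAt` CENTRE-BLIND, verbatim), door module
`…GuardedZBLam{,Print} ↦ …GuardedZBLam{,Print}Ax` (this seat, H3.3), crux decl `Record13SepCoPHInhabited ↦ Record13SepCoPHInhabitedAx` }.  Every proof is the source's proof term under σ; theorem
names are the source's (new namespace `…Ax`), except where a name embeds a renamed stem.
HONEST FRAMING OF THE EDITION (binding; the source's framing below carries over verbatim under σ).  Count-neutral kernel bookkeeping; nothing of Bałaban asserted, valued or discharged;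
every ★ theorem CONDITIONAL on its displayed hypotheses (NODE O's wall — the run-wise ∕ comparability ∕ box core of β at the re-centred member — is inhabited nowhere); K0ᴬ 27238 ∕ K1ᴬ 27239 ∕
K3ᴬ 27247 OPEN; N07 ∕ N09 NOT discharged; COUNT 8∕28 · K 1∕4 UNMOVED; R4 = the CONDITIONAL finite-𝕋⁴ rung `BalabanLadder.UV` only — NOT continuum ∕ ℝ⁴ ∕ OS; **the Yang–Mills mass gap (Clay)
is NOT proved by any of this.**

── THE SOURCE's OWN ACCOUNT (σ-applied; «K0⁷» there reads «K0ᴬ» here, «V23 text» reads «re-centred text (V24 candidate, registered by plan g99 — not here)») ──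
WHAT.  K0ᴬ's registered V23 stub 2′∕3 text `K0V23DefsAx.AbsBetaBoxAtThm1WitnessCCMGenGridGZBAxAt F` (door (α)) bills a two-sided |β| box at the letter-free print-regime member
`θ₁₃ᶜᶜᴹᵂᶻᴮ(j; ½; εbg := a₀; …; 0, 0)` of DEF-1's Z3 family at EVERY radius `a₀ > 0`.  β of record at that member is LETTER-BLIND in `j, ε₀, B₃, B₃′, a₁, Efl, logz`
(`K0V23Stub3SocketsAx.betaOfRecord₁₃_zbRegime_letterBlind`, `rfl`) — ONE family `β₁₃(F; a₀, ε₂₉)` — and stub 1ᴮ's ᴮ(8)-token is ANTITONE in the radius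
(`Prop8RegSepTopStepGB.of_le`), so K0ᴬ already follows from strictly WEAKER doors on the radius axis:
* §1 **(α_small)** `K0BoxSmallRadiiAx` — the box at radii `a₀ ≤ a⋆(F)` of the producer's choosing, one member per radius ([I] Thm 3 p.264 l.30–35: the radii depend on `M`);
  `k0BoxSmallRadii_of_tokenFreeCore` (the every-radius core gives it, `a⋆ := 1`); ★ `record13SepCoPHInhabitedAx_of_k0BoxSmallRadii`.
* §2 **(α_cof)** `K0BoxCofinalRadiiAx` — the box at SOME radius below every ceiling (cofinal at 0); `k0BoxCofinalRadii_of_k0BoxSmallRadii`; ★ `record13SepCoPHInhabitedAx_of_k0BoxCofinalRadii`.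
* §3 **(κ_cof)** `K0CompCofinalRadiiAx` — the COMPARABILITY letter (consecutive couplings of every run staying in `]0, γ₀]` are 2-comparable both ways) at ONE member at
  COFINAL radii — the weakest K0ᴬ-sufficient NODE-O input typed anywhere; `k0CompCofinalRadii_of_k0BoxCofinalRadii`; ★ `record13SepCoPHInhabitedAx_of_k0CompCofinalRadii`
  (through `K0V23Stub3ComparabilitySuppliersAx.exists_k0H_of_thm1CoP7MGB_of_gauge9GB_of_twoComparableZB_lam`).
Each closer is PART 1's eight lines (seam `rfl` post-seam, stub 1ᴮ's closer `K0V23Stub1Closer.stub_prop8StepCoPGridGB13` SHRUNK to the door's radius, stub 2′'s sentence from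
[6] Prop. 6 as printed, the (9)-supplier `gauge9SupplierG3B_of_prop6MemberP` re-run above a prescribed cube exponent, module 53's (8)-sentence, the box∕letter moved to the
supplier's member by the census, `exists_k0H_of_thm1CoP7MGB_of_gauge9GB_of_{absBoxZB,twoComparableZB}_lam` with `εbg := a₀`).

PURPOSE (the only one, №398 (B)): BY-NAME TARGETS for the NODE O cover's lens lines — a line may conclude stub 2′'s statement by name OR the weakest door it honestly
reaches (`K0CompCofinalRadiiAx` ∕ `K0BoxCofinalRadiiAx` ∕ `K0BoxSmallRadiiAx`), importing this leaf.

HONEST FRAMING.  Door BOOKKEEPING over accepted tree names: every door is a HYPOTHESIS, every ★ theorem is CONDITIONAL on its door; nothing of Bałaban's [I] Thm 2 ∕ Thm 3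
remainder estimate is asserted, valued or discharged; no door is inhabited here; K0ᴬ `Record13SepCoPHInhabitedAx` is NOT closed (V23 skeleton d01c50abc247f5ff of record, stub 2′
OPEN); NODE O not inhabited (objects 0∕1); COUNT 8∕28 (8∕27 excl. NODE O) · K 1∕4 UNMOVED; one finite `𝕋⁴_{L^K}` programme at fixed ε — NOT continuum ∕ ℝ⁴ ∕ OS; **the
Yang–Mills mass gap (Clay) is NOT proved by any of this.**  No `sorry`, `instance`, `notation`; standard axioms.
-/

noncomputable section

open MeasureTheory
open scoped Matrix.Norms.L2Operator
open Literature.MathematicalPhysics.QuantumFieldTheory.Balaban1983to89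
open Literature.MathematicalPhysics.QuantumFieldTheory.Balaban1983to89.Node00
open Literature.MathematicalPhysics.QuantumFieldTheory.Balaban1983to89.T4Continuum
open Literature.MathematicalPhysics.QuantumFieldTheory.Balaban1983to89.FlowStep
open Literature.MathematicalPhysics.QuantumFieldTheory.Balaban1983to89.FlowStepRuns
open Literature.MathematicalPhysics.QuantumFieldTheory.Balaban1983to89.B15DeterminingSets
open Literature.MathematicalPhysics.QuantumFieldTheory.Balaban1983to89.B8LeafModelZd (ZdIdx)
open Summit.QuantumFields.YangMills.Theorems.K0PrintCubeOfStepTokensGridGuardedB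
open Summit.QuantumFields.YangMills.Theorems.K0AllTorusOfStepTokensGuardedZBLamAx
open Summit.QuantumFields.YangMills.BalabanUVNodes.N07Thm1Top7FromProp8GuardedB
open Literature.MathematicalPhysics.QuantumFieldTheory.Balaban1983to89.B8Prop6PrintedZdCubPGamma (prop6Printed_zdCubP_γ_holds_pos)
open Summit.QuantumFields.YangMills.Theorems.K0V23DefsAx (AbsBetaBoxAtThm1WitnessCCMGenGridGZBAxAt)
open Summit.QuantumFields.YangMills.Theorems.K0V23Stub3RunwiseSuppliers (runAbsBound_of_absBox)
open Summit.QuantumFields.YangMills.Theorems.K0V23Stub3ComparabilitySuppliers (exists_twoComparable_of_runAbsBound)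

namespace Summit.QuantumFields.YangMills.Theorems.K0V23Stub3DoorSuppliersAx

/-! ## §0  Shared helpers (PART 1 ingredients; `private` — public copies live in the Cruxes sketches of CRIT-1 ∕ lens-1) -/

/-- POST-SEAM the seam is `rfl` (= CRIT-1's `hseam_rfl`). [cite: Balaban1988Convergent, (2.12)–(2.13) pp.256–257] -/
private theorem hseam_rfl :
    ∀ (F : T4Family) (θ : Stage13Params F 2) (p : B12.RunParams) (n : ℕ) (s : SeqOfRecord F θ.ν θ.τ9.M (gOfRecord₁₃Ax F 2 θ p) p.K (n + 1)) (W : MSField (F.P p.K) (SU 2)),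
      UbgOfRecord₁₃CoPChi F 2 θ (chiβOfRecord₁₃Ax F 2 θ) p (n + 1) s W = UbgMSCoPOfRecordB F 2 θ.ν θ.τ9.M (gOfRecord₁₃Ax F 2 θ p) p.K (n + 1) s W :=
  fun _ _ _ _ _ _ => rfl

/-- Stub 2′'s sentence from green Literature (= CRIT-1's `prop6MemberB8AtP_of_b8Printed`). [cite: Balaban1985RegularSpaces, Prop. 6 (1.135)–(1.138) p.99] -/
private theorem prop6MemberB8AtP_of_b8Printed :
    ∀ F : T4Family, ∃ (ρ₀ : ℕ) (B₁ c₁ : ℝ), 1 ≤ ρ₀ ∧ 0 ≤ B₁ ∧ 0 < c₁ ∧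
      (letI : CStarAlgebra (MatA 2) := {}; B8.Prop6Printed 4 (F.L : ℝ) B₁ c₁ (fun i : ZdIdx 4 F.L => zdCubP (MatA 2) F.L ρ₀ i)) := by
  intro F
  letI : CStarAlgebra (MatA 2) := {}
  have hL5 : 5 ≤ F.L := by have := F.hL11; omega
  obtain ⟨ρ₀, B₁, c₁, hρ₀, hB₁, hc₁, H⟩ :=
    prop6Printed_zdCubP_γ_holds_pos (𝔸 := MatA 2) (d := 4) (by norm_num) hL5 F.hL.1
  exact ⟨ρ₀, B₁, c₁, hρ₀, hB₁.le, hc₁, H (fun i : ZdIdx 4 F.L => i)⟩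

/-- **The (9)-supplier above any prescribed cube exponent `j₀`** — `gauge9SupplierG3B_of_prop6MemberP` re-run at the guard letter `max c (L^{j₀})` (stub 1ᴮ's (8)-sentence is antitone in
the guard, `Prop8RegSepTopStepGB.of_imp`), so its cube letter `j` satisfies `L^{j₀} ≤ max c (L^{j₀}) ≤ c′ ≤ L^j`, i.e. `j₀ ≤ j`.
[cite: Balaban1985Variational, Prop. 8 p.304, Thm 1 (9) p.279; Balaban1985RegularSpaces, Prop. 6 p.99; Balaban1987RG1, (1.12) p.262] -/
private theorem gauge9Supplier_ge (F : T4Family) (j₀ : ℕ)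
    (h2P : ∃ (ρ₀ : ℕ) (B₁ cP : ℝ), 1 ≤ ρ₀ ∧ 0 ≤ B₁ ∧ 0 < cP ∧
      (letI : CStarAlgebra (MatA 2) := {}; B8.Prop6Printed 4 (F.L : ℝ) B₁ cP (fun i : ZdIdx 4 F.L => zdCubP (MatA 2) F.L ρ₀ i)))
    (c c₀ c₁ : ℕ) (B₃ a₀ a₁ : ℝ) (hB₃ : 2 * (F.L : ℝ) ^ 2 ≤ B₃) (ha₀ : 0 < a₀) (ha₁ : 0 < a₁)
    (h8 : Prop8RegSepTopStepGB F 2 (fun ν K Ω => suppDomOfRecord F ν K Ω) (fun ν M g K k _s => c ≤ ν.M₁ ∧ k + c₀ ≤ F.m + K ∧ F.L ^ c₁ ∣ M ∧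
      ∀ i, 1 ≤ i → i ≤ k → dCubeSide (F.P K).L M (RkOfRecord (F.P K).L ν.r (g i)) i ∣ (F.P K).sitesPerDir 0) (lamDatum F) (dataSmall7LamTopOf F 2) B₃ a₀ a₁) :
    ∃ (j c' : ℕ) (B₉ a₁' : ℝ), j₀ ≤ j ∧ c ≤ c' ∧ c' ≤ F.L ^ j ∧ c₀ ≤ j + 1 ∧ c₁ ≤ j ∧ 0 < B₉ ∧ 0 < a₁' ∧ a₁' ≤ a₁ ∧
      Gauge9RegSepTopStepGB F 2 (fun ν K Ω => suppDomOfRecord F ν K Ω) (F.L ^ j) (fun ν M g K k _s => c' ≤ ν.M₁ ∧ k + c₀ ≤ F.m + K ∧ F.L ^ c₁ ∣ M ∧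
      ∀ i, 1 ≤ i → i ≤ k → dCubeSide (F.P K).L M (RkOfRecord (F.P K).L ν.r (g i)) i ∣ (F.P K).sitesPerDir 0) (lamDatum F) (dataSmall7LamTopOf F 2) B₃ B₉ a₀ a₁' := by
  have h8' : Prop8RegSepTopStepGB F 2 (fun ν K Ω => suppDomOfRecord F ν K Ω)
      (fun ν M g K k _s => max c (F.L ^ j₀) ≤ ν.M₁ ∧ k + c₀ ≤ F.m + K ∧ F.L ^ c₁ ∣ M ∧
        ∀ i, 1 ≤ i → i ≤ k → dCubeSide (F.P K).L M (RkOfRecord (F.P K).L ν.r (g i)) i ∣ (F.P K).sitesPerDir 0) (lamDatum F) (dataSmall7LamTopOf F 2) B₃ a₀ a₁ :=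
    h8.of_imp fun _ _ _ _ _ _ h => ⟨(le_max_left _ _).trans h.1, h.2⟩
  obtain ⟨j, c', B₉, a₁', hcc', hc', hc₀, hc₁, hB₉, ha₁', hle, h9⟩ :=
    gauge9SupplierG3B_of_prop6MemberP F h2P (lamDatum F) (dataSmall7LamTopOf F 2) (max c (F.L ^ j₀)) c₀ c₁ B₃ a₀ a₁ hB₃ ha₀ ha₁ h8'
  have hL1 : 1 < F.L := F.hL.2
  have hpow : F.L ^ j₀ ≤ F.L ^ j := (le_max_right _ _).trans (hcc'.trans hc')
  have hj : j₀ ≤ j := (Nat.pow_le_pow_iff_right hL1).mp hpow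
  exact ⟨j, c', B₉, a₁', hj, (le_max_left _ _).trans hcc', hc', hc₀, hc₁, hB₉, ha₁', hle, h9⟩

/-! ## §1  DOOR (α_small) — the box at SMALL radii only (lens-1 «cauchy-analytic», `nodeO-cover/LENS-1-DoorEv.lean` §4 verbatim) -/

/-- **Door (α_small): the box of `β₁₃(F; a₀, ε₂₉)` at SMALL radii only, one print-regime member per radius** — for every family SOME `a⋆ > 0` such that for every radius
`0 < a₀ ≤ a⋆` SOME `γ₀, ε₂₉ > 0`, `β′` and SOME member letters `(j, ε₀, B₃, B₃′, a₁, Efl, logz)` box the half-window member on `]0, γ₀]`.  WEAKER than the token-free core of record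
(every radius): `k0BoxSmallRadii_of_tokenFreeCore`. (HYPOTHESIS — door bookkeeping over accepted tree names, NOT a published result; locators: [I], Thm 1 p.259, Thm 3 p.264, (1.20)–(1.22) p.264, (2.9) p.266; open) -/
def K0BoxSmallRadiiAx : Prop :=
  ∀ F : T4Family, ∃ aS : ℝ, 0 < aS ∧ ∀ a₀ : ℝ, 0 < a₀ → a₀ ≤ aS →
    ∃ (γ₀ ε₂₉ β' : ℝ) (j : ℕ) (ε₀ B₃ B₃' a₁ : ℝ) (Efl logz : B12.RunParams → ℕ → ℝ), 0 < γ₀ ∧ 0 < ε₂₉ ∧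
      BetaLowerH (-β') γ₀ (betaOfRecord₁₃Ax F 2 (theta13OfThm1CCMWZBAx F 2 j (1 / 2) a₀ ε₀ ε₂₉ B₃ B₃' a₀ a₁ Efl logz)) ∧
      BetaUpperH β' γ₀ (betaOfRecord₁₃Ax F 2 (theta13OfThm1CCMWZBAx F 2 j (1 / 2) a₀ ε₀ ε₂₉ B₃ B₃' a₀ a₁ Efl logz))

/-- The token-free core of record (a box at EVERY radius) gives door (α_small) (`a⋆ := 1`). [cite: Balaban1987RG1, Thm 1 p.259 (bookkeeping)] -/
theorem k0BoxSmallRadii_of_tokenFreeCore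
    (box : ∀ (F : T4Family) (a₀ : ℝ), 0 < a₀ → ∃ γ₀ ε₂₉ β' : ℝ, 0 < γ₀ ∧ 0 < ε₂₉ ∧ ∀ (j : ℕ) (ε₀ B₃ B₃' a₁ : ℝ),
      BetaLowerH (-β') γ₀ (betaOfRecord₁₃Ax F 2 (theta13OfThm1CCMWZBAx F 2 j (1 / 2) a₀ ε₀ ε₂₉ B₃ B₃' a₀ a₁ (fun _ _ => 0) (fun _ _ => 0))) ∧
      BetaUpperH β' γ₀ (betaOfRecord₁₃Ax F 2 (theta13OfThm1CCMWZBAx F 2 j (1 / 2) a₀ ε₀ ε₂₉ B₃ B₃' a₀ a₁ (fun _ _ => 0) (fun _ _ => 0)))) :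
    K0BoxSmallRadiiAx := fun F =>
  ⟨1, one_pos, fun a₀ ha₀ _ => by
    obtain ⟨γ₀, ε₂₉, β', hγ₀, hε, h⟩ := box F a₀ ha₀
    exact ⟨γ₀, ε₂₉, β', 0, 0, 0, 0, 0, fun _ _ => 0, fun _ _ => 0, hγ₀, hε, h 0 0 0 0 0⟩⟩

/-- **★ K0ᴬ's DECL FROM DOOR (α_small) ALONE, BY NAME**: stub 1ᴮ's token (✓`stub_prop8StepCoPGridGB13`) SHRUNK to the radius `min a₀ a⋆` by `Prop8RegSepTopStepGB.of_le` (antitone in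
`a₀`), the (9)-supplier at that radius (`gauge9Supplier_ge`), module 53's (8)-sentence, the box at that small radius moved to the supplier's member by the census
(`betaOfRecord₁₃_zbRegime_letterBlind`), PART 1's `exists_k0H_of_thm1CoP7MGB_of_gauge9GB_of_absBoxZBAx_lam` with `εbg := a₀ := min a₀ a⋆`.  CONDITIONAL on (α_small); K0ᴬ NOT closed.
[cite: Balaban1985Variational, Thm 1 (8)–(9) p.279, Prop. 8 p.304; Balaban1985RegularSpaces, Prop. 6 p.99; Balaban1988Convergent, Thm 1 p.262, (2.12)–(2.13) pp.256–257; Balaban1987RG1, Thm 1 p.259, Thm 3 p.264, (1.20)–(1.22) p.264] -/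
theorem record13SepCoPHInhabitedAx_of_k0BoxSmallRadii (h : K0BoxSmallRadiiAx) :
    Summit.QuantumFields.YangMills.Theses.BalabanUVNodes.Record13SepCoPHInhabitedAx := by
  intro F
  obtain ⟨aS, haS, hbox⟩ := h F
  obtain ⟨c, c₀, c₁, B₃, a₀, a₁, hB₃, ha₀, ha₁, h8⟩ := Summit.QuantumFields.YangMills.Theorems.K0V23Stub1Closer.stub_prop8StepCoPGridGB13 F
  have ha : 0 < min a₀ aS := lt_min ha₀ haS
  have h8a := h8.of_le (min_le_left a₀ aS) le_rfl
  have hL : (0 : ℝ) < (F.L : ℝ) := by exact_mod_cast lt_trans Nat.zero_lt_one F.hL.2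
  have hBpos : (0 : ℝ) < B₃ := lt_of_lt_of_le (mul_pos two_pos (pow_pos hL 2)) hB₃
  obtain ⟨j, c', B₉, a₁', -, hcc', hc', hc₀, hc₁, hB₉, ha₁', ha₁'le, h9⟩ :=
    gauge9Supplier_ge F 0 (prop6MemberB8AtP_of_b8Printed F) c c₀ c₁ B₃ (min a₀ aS) a₁ hB₃ ha ha₁ h8a
  have h15 : VariationalThm1RegSepCoP7MGB F 2 (fun ν M g K k _s => c' ≤ ν.M₁ ∧ k + c₀ ≤ F.m + K ∧ F.L ^ c₁ ∣ M ∧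
      ∀ i, 1 ≤ i → i ≤ k → dCubeSide (F.P K).L M (RkOfRecord (F.P K).L ν.r (g i)) i ∣ (F.P K).sitesPerDir 0) (lamDatum F) (dataSmall7LamTopOf F 2) B₃ (min a₀ aS) a₁' :=
    (variationalThm1RegSepCoP7MGB_of_prop8TopStepGB_lamDatum hBpos (h8a.of_le le_rfl ha₁'le)).of_imp fun _ _ _ _ _ _ h => ⟨hcc'.trans h.1, h.2⟩
  obtain ⟨γ₀, ε₂₉, β', j₁, ε₀, C₃, C₃', c₁', Efl, logz, hγ₀, hε₂₉, hlow, hup⟩ := hbox (min a₀ aS) ha (min_le_right a₀ aS)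
  rw [Summit.QuantumFields.YangMills.Theorems.K0V23Stub3SocketsAx.betaOfRecord₁₃_zbRegime_letterBlind F j₁ j (min a₀ aS) ε₀ 1 ε₂₉ C₃ B₃ C₃' B₉ c₁' a₁' Efl logz
    (fun _ _ => 0) (fun _ _ => 0)] at hlow hup
  exact exists_k0H_of_thm1CoP7MGB_of_gauge9GB_of_absBoxZBAx_lam F hc' hc₀ hc₁ ha hBpos.le hB₉.le ha ha₁' h15 h9
    (fun θ p n s δ W hn hpc h7 => hDat_dataSmall7LamTopOfAx F 2 θ p n s δ W hn hpc h7) (hseam_rfl F) ⟨γ₀, 1, ε₂₉, β', hγ₀, one_pos, hε₂₉, hlow, hup⟩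

/-! ## §2  DOOR (α_cof) — the box at ONE member for radii ACCUMULATING AT 0 (P3 g84, LENS «weaken the target», `SketchDoorCof.lean` §5 verbatim) -/

/-- **Door (α_cof)**: for every family and every `a > 0` SOME radius `0 < a₀ ≤ a`, SOME `γ₀, ε₂₉ > 0`, `β′` and SOME member letters box the half-window member on `]0, γ₀]`.
(HYPOTHESIS — door bookkeeping over accepted tree names, NOT a published result; locators: [I], Thm 1 p.259, Thm 3 p.264, (1.20)–(1.22) p.264, (2.9) p.266 (bookkeeping); open) -/
def K0BoxCofinalRadiiAx : Prop :=
  ∀ F : T4Family, ∀ a : ℝ, 0 < a → ∃ a₀ : ℝ, 0 < a₀ ∧ a₀ ≤ a ∧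
    ∃ (γ₀ ε₂₉ β' : ℝ) (j : ℕ) (ε₀ B₃ B₃' a₁ : ℝ) (Efl logz : B12.RunParams → ℕ → ℝ), 0 < γ₀ ∧ 0 < ε₂₉ ∧
      BetaLowerH (-β') γ₀ (betaOfRecord₁₃Ax F 2 (theta13OfThm1CCMWZBAx F 2 j (1 / 2) a₀ ε₀ ε₂₉ B₃ B₃' a₀ a₁ Efl logz)) ∧
      BetaUpperH β' γ₀ (betaOfRecord₁₃Ax F 2 (theta13OfThm1CCMWZBAx F 2 j (1 / 2) a₀ ε₀ ε₂₉ B₃ B₃' a₀ a₁ Efl logz))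

/-- (α_small) ⟹ (α_cof): take `a₀ := min a a⋆`. [cite: Balaban1987RG1, Thm 1 p.259 (bookkeeping)] -/
theorem k0BoxCofinalRadii_of_k0BoxSmallRadii (h : K0BoxSmallRadiiAx) : K0BoxCofinalRadiiAx := by
  intro F a ha
  obtain ⟨aS, haS, hbox⟩ := h F
  exact ⟨min a aS, lt_min ha haS, min_le_left a aS, hbox (min a aS) (lt_min ha haS) (min_le_right a aS)⟩

/-- **★ K0ᴬ's DECL FROM DOOR (α_cof) ALONE, BY NAME** — lens-1's `record13SepCoPHInhabitedAx_of_k0BoxSmallRadii` with the radius choice changed: the closer's ∃-radius `aS`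
is handed to the door as the ceiling `a`, the door returns SOME `a₀ ≤ aS` with a box, and stub 1ᴮ's token is shrunk to `a₀` by `Prop8RegSepTopStepGB.of_le`; every later step verbatim.
CONDITIONAL on (α_cof); K0ᴬ NOT closed. [cite: Balaban1985Variational, Thm 1 (8)–(9) p.279, Prop. 8 p.304; Balaban1985RegularSpaces, Prop. 6 p.99; Balaban1988Convergent, Thm 1 p.262; Balaban1987RG1, Thm 1 p.259, Thm 3 p.264, (1.20)–(1.22) p.264] -/
theorem record13SepCoPHInhabitedAx_of_k0BoxCofinalRadii (h : K0BoxCofinalRadiiAx) :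
    Summit.QuantumFields.YangMills.Theses.BalabanUVNodes.Record13SepCoPHInhabitedAx := by
  intro F
  obtain ⟨c, c₀, c₁, B₃, aS, a₁, hB₃, haS, ha₁, h8⟩ := Summit.QuantumFields.YangMills.Theorems.K0V23Stub1Closer.stub_prop8StepCoPGridGB13 F
  obtain ⟨a₀, ha, hle, hbox⟩ := h F aS haS
  have h8a := h8.of_le hle le_rfl
  have hL : (0 : ℝ) < (F.L : ℝ) := by exact_mod_cast lt_trans Nat.zero_lt_one F.hL.2
  have hBpos : (0 : ℝ) < B₃ := lt_of_lt_of_le (mul_pos two_pos (pow_pos hL 2)) hB₃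
  obtain ⟨j, c', B₉, a₁', -, hcc', hc', hc₀, hc₁, hB₉, ha₁', ha₁'le, h9⟩ :=
    gauge9Supplier_ge F 0 (prop6MemberB8AtP_of_b8Printed F) c c₀ c₁ B₃ a₀ a₁ hB₃ ha ha₁ h8a
  have h15 : VariationalThm1RegSepCoP7MGB F 2 (fun ν M g K k _s => c' ≤ ν.M₁ ∧ k + c₀ ≤ F.m + K ∧ F.L ^ c₁ ∣ M ∧
      ∀ i, 1 ≤ i → i ≤ k → dCubeSide (F.P K).L M (RkOfRecord (F.P K).L ν.r (g i)) i ∣ (F.P K).sitesPerDir 0) (lamDatum F) (dataSmall7LamTopOf F 2) B₃ a₀ a₁' :=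
    (variationalThm1RegSepCoP7MGB_of_prop8TopStepGB_lamDatum hBpos (h8a.of_le le_rfl ha₁'le)).of_imp fun _ _ _ _ _ _ h => ⟨hcc'.trans h.1, h.2⟩
  obtain ⟨γ₀, ε₂₉, β', j₁, ε₀, C₃, C₃', c₁', Efl, logz, hγ₀, hε₂₉, hlow, hup⟩ := hbox
  rw [Summit.QuantumFields.YangMills.Theorems.K0V23Stub3SocketsAx.betaOfRecord₁₃_zbRegime_letterBlind F j₁ j a₀ ε₀ 1 ε₂₉ C₃ B₃ C₃' B₉ c₁' a₁' Efl logz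
    (fun _ _ => 0) (fun _ _ => 0)] at hlow hup
  exact exists_k0H_of_thm1CoP7MGB_of_gauge9GB_of_absBoxZBAx_lam F hc' hc₀ hc₁ ha hBpos.le hB₉.le ha ha₁' h15 h9
    (fun θ p n s δ W hn hpc h7 => hDat_dataSmall7LamTopOfAx F 2 θ p n s δ W hn hpc h7) (hseam_rfl F) ⟨γ₀, 1, ε₂₉, β', hγ₀, one_pos, hε₂₉, hlow, hup⟩

/-! ## §3  DOOR (κ_cof) — COMPARABILITY shape × ONE member × COFINAL radii: the weakest typed corner (P3 g84, `SketchDoorCof.lean` §6 verbatim) -/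

/-- **Door (κ_cof)** (comparability letter, one member, cofinal radii). (HYPOTHESIS — door bookkeeping over accepted tree names, NOT a published result; locators: [I], Thm 1 p.259, Thm 3 p.264, (0.20) p.256, (1.20)–(1.22) p.264 (bookkeeping); open) -/
def K0CompCofinalRadiiAx : Prop :=
  ∀ F : T4Family, ∀ a : ℝ, 0 < a → ∃ a₀ : ℝ, 0 < a₀ ∧ a₀ ≤ a ∧
    ∃ (γ₀ ε₂₉ : ℝ) (j : ℕ) (ε₀ B₃ B₃' a₁ : ℝ) (Efl logz : B12.RunParams → ℕ → ℝ), 0 < γ₀ ∧ 0 < ε₂₉ ∧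
      ∀ (n : ℕ) (gs : ℕ → ℝ), RGEqH n (betaOfRecord₁₃Ax F 2 (theta13OfThm1CCMWZBAx F 2 j (1 / 2) a₀ ε₀ ε₂₉ B₃ B₃' a₀ a₁ Efl logz)) gs → Step.InInterval γ₀ n gs →
        ∀ m, m < n → gs m ≤ 2 * gs (m + 1) ∧ gs (m + 1) ≤ 2 * gs m

/-- (α_cof) ⟹ (κ_cof): a box at a member gives the comparability letter at that member (`K0V23Stub3ComparabilitySuppliers` §1 via the run letter:
`twoComparableZBAt_of_runAbsBoxZB`-style bookkeeping, here through `exists_twoComparable_of_runAbsBound` on the run bound a box trivially gives). -/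
theorem k0CompCofinalRadii_of_k0BoxCofinalRadii (h : K0BoxCofinalRadiiAx) : K0CompCofinalRadiiAx := by
  intro F a ha
  obtain ⟨a₀, ha₀, hle, γ₀, ε₂₉, β', j, ε₀, B₃, B₃', a₁, Efl, logz, hγ₀, hε, hlow, hup⟩ := h F a ha
  obtain ⟨γ₁, hγ₁, -, -, hC⟩ := Summit.QuantumFields.YangMills.Theorems.K0V23Stub3ComparabilitySuppliers.exists_twoComparable_of_runAbsBound hγ₀
    (Summit.QuantumFields.YangMills.Theorems.K0V23Stub3RunwiseSuppliers.runAbsBound_of_absBox hlow hup)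
  exact ⟨a₀, ha₀, hle, γ₁, ε₂₉, j, ε₀, B₃, B₃', a₁, Efl, logz, hγ₁, hε, hC⟩

/-- **★ K0ᴬ's DECL FROM DOOR (κ_cof) ALONE, BY NAME.**  CONDITIONAL on (κ_cof); K0ᴬ NOT closed. [cite: Balaban1985Variational, Thm 1 (8)–(9) p.279, Prop. 8 p.304; Balaban1985RegularSpaces, Prop. 6 p.99;
Balaban1988Convergent, Thm 1 p.262, (2.12)–(2.13) pp.256–257; Balaban1987RG1, Thm 1 p.259, Thm 3 p.264, (0.20) p.256, (1.20)–(1.22) p.264] -/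
theorem record13SepCoPHInhabitedAx_of_k0CompCofinalRadii (h : K0CompCofinalRadiiAx) :
    Summit.QuantumFields.YangMills.Theses.BalabanUVNodes.Record13SepCoPHInhabitedAx := by
  intro F
  obtain ⟨c, c₀, c₁, B₃, aS, a₁, hB₃, haS, ha₁, h8⟩ := Summit.QuantumFields.YangMills.Theorems.K0V23Stub1Closer.stub_prop8StepCoPGridGB13 F
  obtain ⟨a₀, ha, hle, hcomp⟩ := h F aS haS
  have h8a := h8.of_le hle le_rfl
  have hL : (0 : ℝ) < (F.L : ℝ) := by exact_mod_cast lt_trans Nat.zero_lt_one F.hL.2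
  have hBpos : (0 : ℝ) < B₃ := lt_of_lt_of_le (mul_pos two_pos (pow_pos hL 2)) hB₃
  obtain ⟨j, c', B₉, a₁', -, hcc', hc', hc₀, hc₁, hB₉, ha₁', ha₁'le, h9⟩ :=
    gauge9Supplier_ge F 0 (prop6MemberB8AtP_of_b8Printed F) c c₀ c₁ B₃ a₀ a₁ hB₃ ha ha₁ h8a
  have h15 : VariationalThm1RegSepCoP7MGB F 2 (fun ν M g K k _s => c' ≤ ν.M₁ ∧ k + c₀ ≤ F.m + K ∧ F.L ^ c₁ ∣ M ∧
      ∀ i, 1 ≤ i → i ≤ k → dCubeSide (F.P K).L M (RkOfRecord (F.P K).L ν.r (g i)) i ∣ (F.P K).sitesPerDir 0) (lamDatum F) (dataSmall7LamTopOf F 2) B₃ a₀ a₁' :=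
    (variationalThm1RegSepCoP7MGB_of_prop8TopStepGB_lamDatum hBpos (h8a.of_le le_rfl ha₁'le)).of_imp fun _ _ _ _ _ _ h => ⟨hcc'.trans h.1, h.2⟩
  obtain ⟨γ₀, ε₂₉, j₁, ε₀, C₃, C₃', c₁', Efl, logz, hγ₀, hε₂₉, hC⟩ := hcomp
  rw [Summit.QuantumFields.YangMills.Theorems.K0V23Stub3SocketsAx.betaOfRecord₁₃_zbRegime_letterBlind F j₁ j a₀ ε₀ 1 ε₂₉ C₃ B₃ C₃' B₉ c₁' a₁' Efl logz
    (fun _ _ => 0) (fun _ _ => 0)] at hC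
  exact Summit.QuantumFields.YangMills.Theorems.K0V23Stub3ComparabilitySuppliersAx.exists_k0H_of_thm1CoP7MGB_of_gauge9GB_of_twoComparableZB_lam F
    hc' hc₀ hc₁ ha hBpos.le hB₉.le ha ha₁' h15 h9
    (fun θ p n s δ W hn hpc h7 => hDat_dataSmall7LamTopOfAx F 2 θ p n s δ W hn hpc h7) (hseam_rfl F) ⟨γ₀, 1, ε₂₉, hγ₀, one_pos, hε₂₉, hC⟩

end Summit.QuantumFields.YangMills.Theorems.K0V23Stub3DoorSuppliersAx

end
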